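import Mathlib.Analysis.SpecialFunctions.Log.Base
import Literature.Computability.AlgebraicComplexity.QuantumFunctionalsDirectSumEntropy
import HarnessLib

/-!
# Quantum functionals and direct sums: super-additivity (CVZ Thm. 3.19.2) and the additivity fact

Topic: `Literature/Computability/AlgebraicComplexity`, companion to `QuantumFunctionals.lean`
(Christandl–Vrana–Zuiddam, *Universal points in the asymptotic spectrum of tensors*,
arXiv:1709.07851v3 = J. Amer. Math. Soc. 36 (2023); numbering of that version). The tree's named
fact `ChristandlVranaZuiddam2023_directSum` is the additivity `F_θ(s ⊕ t) = F_θ(s) + F_θ(t)`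
(Cor. 3.31) of the quantum functional `F_θ = 2^{E_θ}` of Def. 3.16 (`quantumFunctional`,
`logQuantumFunctional`: the supremum of the `θ`-weighted marginal entropies over the
`GL × GL × GL`-orbit). In the source the two inequalities have proofs of very different weight:

* `≥` (super-additivity) is Thm. 3.19.2 = Lemma 3.22, an explicit construction: for orbit points
  `u = g·s`, `v = g'·t` rescaled to squared norms `p`, `1-p`, the marginals of `u ⊕ v` are the block
  sums `p ρ_j(u) ⊕ (1-p) ρ_j(v)`, so by the recursion property of entropy (Lemma 3.21)
  `H_θ(u ⊕ v) = p H_θ(u) + (1-p) H_θ(v) + h(p)`, and the entropy trick (Lemma 3.12)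
  `max_p 2^{p a + (1-p) b + h(p)} = 2^a + 2^b` gives `F_θ(s ⊕ t) ≥ F_θ(s) + F_θ(t)`.
  **This half is proved here** (`quantumFunctional_add_le_directSumTensor`,
  `ChristandlVranaZuiddam2023_directSum_superadditive_holds`), on top of the marginal and entropy
  computations of `QuantumFunctionalsDirectSumMarginals.lean` and
  `QuantumFunctionalsDirectSumEntropy.lean` (`actTensor_directSum`, `quantumEntropy_smul`,
  `quantumEntropy_directSumTensor`, …).
* `≤` (sub-additivity) is proved in the source only for the representation-theoretic upper
  functional `F^θ` of Def. 3.3 (Lemma 3.11 = Thm. 3.5.2: Schur–Weyl duality, the semigroup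
  property of Littlewood–Richardson coefficients, Lemma 3.10.2) and transported along
  `F^θ = F_θ` (Thm. 3.30, resting on the Keyl–Werner spectrum estimation theorem 3.27 and the
  invariant-theoretic description of the entanglement polytope, Thm. 3.29, due to
  Ness–Mumford/Brion/Walter–Doran–Gross–Christandl). None of this machinery is in the tree; this
  half is vendored as the named fact `ChristandlVranaZuiddam2023_directSum_subadditive`, and
  `ChristandlVranaZuiddam2023_directSum_of_subadditive` /
  `ChristandlVranaZuiddam2023_directSum_iff_subadditive` reduce the tree's fact to it.

## Content

* `exists_gl_fromBlocks_smul` — block-diagonal invertible matrices with rescaled blocks (the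
  embedding `G_s × G_t → G_{s ⊕ t}` composed with the scalars of the normalisation).
* `negMulLog_weights_add_eq_logb` — the entropy trick (Lemma 3.12) at its maximiser
  `p = 2^a/(2^a + 2^b)`: `h(p) + p a + (1-p) b = log₂(2^a + 2^b)`.
* `quantumEntropy_directSumTensor_smul_le`, `logb_two_rpow_add_le_logQuantumFunctional`,
  `rpow_add_rpow_le_rpow_logQuantumFunctional` — the construction of Lemma 3.22 for one pair of
  orbit points; `rpow_logQuantumFunctional_add_le` — `2^{E_θ(s)} + 2^{E_θ(t)} ≤ 2^{E_θ(s ⊕ t)}`;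
  `quantumFunctional_add_le_directSumTensor` — `F_θ(s) + F_θ(t) ≤ F_θ(s ⊕ t)`, including the
  degenerate cases `s = 0` or `t = 0` (`F_θ(0) = 0`, and `E_θ(t) ≤ E_θ(0 ⊕ t)`).
* Named facts `ChristandlVranaZuiddam2023_directSum_superadditive` (discharged: `…_holds`) and
  `ChristandlVranaZuiddam2023_directSum_subadditive`, the assembly
  `ChristandlVranaZuiddam2023_directSum_of_subadditive`, the projection
  `ChristandlVranaZuiddam2023_directSum.subadditive` and the equivalence
  `ChristandlVranaZuiddam2023_directSum_iff_subadditive`.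

## Design notes

* Injectivity of the `GL³`-action is not used: in `rpow_add_rpow_le_rpow_logQuantumFunctional` an
  orbit point that would vanish is replaced by `s = 1·s` itself, whose entropy is at least
  `H_θ(0) = 0`.
* The two suprema in `E_θ(s)`, `E_θ(t)` are discharged one at a time through
  `x ≤ log₂ y ↔ 2^x ≤ y` (`Real.le_logb_iff_rpow_le`), so no continuity of `2^x` along `iSup` is
  used.
* Junk values follow `QuantumFunctionals.lean`: `r_j(0) = 0`, `H_θ(0) = 0`, `F_θ(0) = 0`.

## Not here

The sub-additive half (and with it `ChristandlVranaZuiddam2023_directSum_holds`): it needs the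
upper functional `E^θ` (isotypic projectors `P_λ` on `(ℂ^d)^{⊗n}`; the tree has Specht modules and
their characters in `Literature/NumberTheory/DiophantineGeometry/SymmetricGroupReps.lean`),
Lemma 3.11, Thm. 3.24 (spectrum estimation) and Thm. 3.29/3.30 (entanglement polytope), each a
separate development.
-/

noncomputable section

open scoped BigOperators Matrix ComplexOrder
open Real (negMulLog)

namespace Literature.Computability.AlgebraicComplexity

universe u

/-! ## Glue: block-diagonal invertible matrices and the entropy trick -/

section Glue

variable {K : Type*} {ι ι' : Type*} [Fintype ι] [Fintype ι']

/-- A block-diagonal matrix with invertible (scaled) diagonal blocks is invertible. [folklore] -/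
theorem exists_gl_fromBlocks_smul [Field K] [DecidableEq ι] [DecidableEq ι'] (g : GL ι K)
    (g' : GL ι' K) {x y : K} (hx : x ≠ 0) (hy : y ≠ 0) :
    ∃ G : GL (ι ⊕ ι') K, (G : Matrix (ι ⊕ ι') (ι ⊕ ι') K) =
      Matrix.fromBlocks (x • (g : Matrix ι ι K)) 0 0 (y • (g' : Matrix ι' ι' K)) := by
  refine ⟨⟨Matrix.fromBlocks (x • (g : Matrix ι ι K)) 0 0 (y • (g' : Matrix ι' ι' K)),
    Matrix.fromBlocks (x⁻¹ • ((g⁻¹ : GL ι K) : Matrix ι ι K)) 0 0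
      (y⁻¹ • ((g'⁻¹ : GL ι' K) : Matrix ι' ι' K)), ?_, ?_⟩, rfl⟩
  · simp [Matrix.fromBlocks_multiply, Matrix.mul_smul, smul_smul, hx, hy]
  · simp [Matrix.fromBlocks_multiply, Matrix.mul_smul, smul_smul, hx, hy]


/-- **The entropy trick** (CVZ Lemma 3.12, quoting [Str91]) at the maximiser `p = 2^a/(2^a+2^b)`:
`h(p) + p a + (1-p) b = log₂(2^a + 2^b)`, with `h(p) = (η(p) + η(1-p))/log 2` and `1 - p` written as
`2^b/(2^a+2^b)`. [cite: ChristandlVranaZuiddam2023, Lemma 3.12] -/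
theorem negMulLog_weights_add_eq_logb (a b : ℝ) :
    (negMulLog ((2 : ℝ) ^ a / ((2 : ℝ) ^ a + (2 : ℝ) ^ b)) +
        negMulLog ((2 : ℝ) ^ b / ((2 : ℝ) ^ a + (2 : ℝ) ^ b))) / Real.log 2 +
      (2 : ℝ) ^ a / ((2 : ℝ) ^ a + (2 : ℝ) ^ b) * a +
        (2 : ℝ) ^ b / ((2 : ℝ) ^ a + (2 : ℝ) ^ b) * b =
      Real.logb 2 ((2 : ℝ) ^ a + (2 : ℝ) ^ b) := by
  have hA : (0 : ℝ) < 2 ^ a := Real.rpow_pos_of_pos two_pos a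
  have hB : (0 : ℝ) < 2 ^ b := Real.rpow_pos_of_pos two_pos b
  have hS : (0 : ℝ) < 2 ^ a + 2 ^ b := add_pos hA hB
  have hl2 : Real.log 2 ≠ 0 := (Real.log_pos one_lt_two).ne'
  rw [Real.logb, Real.negMulLog, Real.negMulLog, Real.log_div hA.ne' hS.ne',
    Real.log_div hB.ne' hS.ne', Real.log_rpow two_pos, Real.log_rpow two_pos]
  field_simp
  ring

end Glue

/-! ## Super-additivity of the quantum functional under direct sum (CVZ Thm. 3.19.2) -/

section Superadditive

variable {ι κ μ ι' κ' μ' : Type*} [Fintype ι] [Fintype κ] [Fintype μ] [Fintype ι'] [Fintype κ']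
  [Fintype μ'] [DecidableEq ι] [DecidableEq κ] [DecidableEq μ] [DecidableEq ι'] [DecidableEq κ']
  [DecidableEq μ']

/-- **Block-diagonal orbit points of `s ⊕ t`**: for invertible `gⱼ`, `g'ⱼ` and nonzero scalars
`x, y`, the tensor `x (g·s) ⊕ y (g'·t)` lies in the `GL³`-orbit of `s ⊕ t`, so its `H_θ` is at
most `E_θ(s ⊕ t)`. [cite: ChristandlVranaZuiddam2023, Lemma 3.22 (proof)] -/
theorem quantumEntropy_directSumTensor_smul_le {θ : Fin 3 → ℝ} (hθ : ∀ i, 0 ≤ θ i)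
    (s : ι → κ → μ → ℂ) (t : ι' → κ' → μ' → ℂ) (g : GL ι ℂ × GL κ ℂ × GL μ ℂ)
    (g' : GL ι' ℂ × GL κ' ℂ × GL μ' ℂ) {x y : ℂ} (hx : x ≠ 0) (hy : y ≠ 0) :
    quantumEntropy θ (directSumTensor
        (x • actTensor g.1.val g.2.1.val g.2.2.val s)
        (y • actTensor g'.1.val g'.2.1.val g'.2.2.val t)) ≤
      logQuantumFunctional θ (directSumTensor s t) := by
  obtain ⟨GA, hGA⟩ := exists_gl_fromBlocks_smul g.1 g'.1 hx hy
  obtain ⟨GB, hGB⟩ := exists_gl_fromBlocks_smul g.2.1 g'.2.1 (one_ne_zero (α := ℂ))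
    (one_ne_zero (α := ℂ))
  obtain ⟨GC, hGC⟩ := exists_gl_fromBlocks_smul g.2.2 g'.2.2 (one_ne_zero (α := ℂ))
    (one_ne_zero (α := ℂ))
  rw [one_smul, one_smul] at hGB hGC
  have hw : actTensor (GA : Matrix (ι ⊕ ι') (ι ⊕ ι') ℂ) (GB : Matrix (κ ⊕ κ') (κ ⊕ κ') ℂ)
      (GC : Matrix (μ ⊕ μ') (μ ⊕ μ') ℂ) (directSumTensor s t) = directSumTensor
        (x • actTensor g.1.val g.2.1.val g.2.2.val s)
        (y • actTensor g'.1.val g'.2.1.val g'.2.2.val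
          t) := by
    rw [hGA, hGB, hGC, actTensor_directSum, ← smul_actTensor_eq_actTensor_smul,
      ← smul_actTensor_eq_actTensor_smul]
  rw [← hw]
  exact quantumEntropy_actTensor_le_logQuantumFunctional hθ (directSumTensor s t) (GA, GB, GC)

omit [Fintype ι'] [Fintype κ'] [Fintype μ'] [DecidableEq ι] [DecidableEq κ] [DecidableEq μ]
  [DecidableEq ι'] [DecidableEq κ'] [DecidableEq μ'] in
/-- `‖x‖² ⟨u|u⟩ = 2^a` for the normalising scalar `x = √(2^a/⟨u|u⟩)`, `u ≠ 0`. [folklore] -/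
theorem tensorNormSq_smul_sqrt {u : ι → κ → μ → ℂ} (hu : u ≠ 0) (a : ℝ) :
    tensorNormSq (((Real.sqrt ((2 : ℝ) ^ a / tensorNormSq u) : ℝ) : ℂ) • u) = (2 : ℝ) ^ a := by
  have hN : 0 < tensorNormSq u :=
    (tensorNormSq_nonneg u).lt_of_ne' (mt (tensorNormSq_eq_zero_iff u).1 hu)
  rw [tensorNormSq_smul, Complex.norm_real, Real.norm_eq_abs, sq_abs,
    Real.sq_sqrt (div_nonneg (Real.rpow_nonneg zero_le_two a) hN.le), div_mul_cancel₀ _ hN.ne']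

omit [Fintype ι'] [Fintype κ'] [Fintype μ'] [DecidableEq ι] [DecidableEq κ] [DecidableEq μ]
  [DecidableEq ι'] [DecidableEq κ'] [DecidableEq μ'] in
/-- The normalising scalar `√(2^a/⟨u|u⟩)` is nonzero for `u ≠ 0`. [folklore] -/
theorem sqrt_smul_ne_zero {u : ι → κ → μ → ℂ} (hu : u ≠ 0) (a : ℝ) :
    ((Real.sqrt ((2 : ℝ) ^ a / tensorNormSq u) : ℝ) : ℂ) ≠ 0 := by
  have hN : 0 < tensorNormSq u :=
    (tensorNormSq_nonneg u).lt_of_ne' (mt (tensorNormSq_eq_zero_iff u).1 hu)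
  exact Complex.ofReal_ne_zero.2 (Real.sqrt_pos.2 (div_pos (Real.rpow_pos_of_pos two_pos a) hN)).ne'

/-- **The construction of CVZ Lemma 3.22**: for nonzero orbit points `u = g·s`, `v = g'·t`,
rescaled to squared norms `2^{H_θ(u)}` and `2^{H_θ(v)}`, the direct sum has
`H_θ = log₂(2^{H_θ(u)} + 2^{H_θ(v)})`, whence this is a lower bound for `E_θ(s ⊕ t)`.
[cite: ChristandlVranaZuiddam2023, Lemma 3.22] -/
theorem logb_two_rpow_add_le_logQuantumFunctional {θ : Fin 3 → ℝ} (hθ : θ ∈ stdSimplex ℝ (Fin 3))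
    (s : ι → κ → μ → ℂ) (t : ι' → κ' → μ' → ℂ) (g : GL ι ℂ × GL κ ℂ × GL μ ℂ)
    (g' : GL ι' ℂ × GL κ' ℂ × GL μ' ℂ)
    (hu : actTensor g.1.val g.2.1.val g.2.2.val s ≠ 0)
    (hv : actTensor g'.1.val g'.2.1.val g'.2.2.val t ≠ 0) :
    Real.logb 2 ((2 : ℝ) ^ quantumEntropy θ
        (actTensor g.1.val g.2.1.val g.2.2.val s) +
      (2 : ℝ) ^ quantumEntropy θ
        (actTensor g'.1.val g'.2.1.val g'.2.2.val t)) ≤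
      logQuantumFunctional θ (directSumTensor s t) := by
  set u := actTensor g.1.val g.2.1.val g.2.2.val s with hu_def
  set v := actTensor g'.1.val g'.2.1.val g'.2.2.val t
    with hv_def
  set a := quantumEntropy θ u
  set b := quantumEntropy θ v
  have hle := quantumEntropy_directSumTensor_smul_le hθ.1 s t g g' (sqrt_smul_ne_zero hu a)
    (sqrt_smul_ne_zero hv b)
  rw [← hu_def, ← hv_def] at hle
  have hval := quantumEntropy_directSumTensor hθ
    (((Real.sqrt ((2 : ℝ) ^ a / tensorNormSq u) : ℝ) : ℂ) • u)
    (((Real.sqrt ((2 : ℝ) ^ b / tensorNormSq v) : ℝ) : ℂ) • v)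
  simp only at hval
  rw [quantumEntropy_smul θ (sqrt_smul_ne_zero hu a),
    quantumEntropy_smul θ (sqrt_smul_ne_zero hv b), tensorNormSq_smul_sqrt hu,
    tensorNormSq_smul_sqrt hv, negMulLog_weights_add_eq_logb] at hval
  rwa [hval] at hle

/-- **Every pair of orbit points gives a lower bound**: `2^{H_θ(g·s)} + 2^{H_θ(g'·t)} ≤
2^{E_θ(s ⊕ t)}` for `s, t ≠ 0` and all `g, g'`. [cite: ChristandlVranaZuiddam2023, Lemma 3.22] -/
theorem rpow_add_rpow_le_rpow_logQuantumFunctional {θ : Fin 3 → ℝ} (hθ : θ ∈ stdSimplex ℝ (Fin 3))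
    {s : ι → κ → μ → ℂ} {t : ι' → κ' → μ' → ℂ} (hs : s ≠ 0) (ht : t ≠ 0)
    (g : GL ι ℂ × GL κ ℂ × GL μ ℂ) (g' : GL ι' ℂ × GL κ' ℂ × GL μ' ℂ) :
    (2 : ℝ) ^ quantumEntropy θ
        (actTensor g.1.val g.2.1.val g.2.2.val s) +
      (2 : ℝ) ^ quantumEntropy θ
        (actTensor g'.1.val g'.2.1.val g'.2.2.val t) ≤
      (2 : ℝ) ^ logQuantumFunctional θ (directSumTensor s t) := by
  -- replace an orbit point that vanishes (impossible, but cheaper than proving so) by `s` itself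
  obtain ⟨g₁, hg₁, hle₁⟩ : ∃ g₁ : GL ι ℂ × GL κ ℂ × GL μ ℂ,
      actTensor g₁.1.val g₁.2.1.val g₁.2.2.val s ≠ 0 ∧
      quantumEntropy θ (actTensor g.1.val g.2.1.val g.2.2.val s)
        ≤ quantumEntropy θ
          (actTensor g₁.1.val g₁.2.1.val g₁.2.2.val s) := by
    by_cases h : actTensor g.1.val g.2.1.val g.2.2.val s = 0
    · refine ⟨(1, 1, 1), by simpa using hs, ?_⟩
      rw [h, quantumEntropy_zero]
      exact quantumEntropy_nonneg hθ.1 _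
    · exact ⟨g, h, le_rfl⟩
  obtain ⟨g₂, hg₂, hle₂⟩ : ∃ g₂ : GL ι' ℂ × GL κ' ℂ × GL μ' ℂ,
      actTensor g₂.1.val g₂.2.1.val g₂.2.2.val t ≠ 0 ∧
      quantumEntropy θ
          (actTensor g'.1.val g'.2.1.val g'.2.2.val t)
        ≤ quantumEntropy θ
          (actTensor g₂.1.val g₂.2.1.val g₂.2.2.val t) := by
    by_cases h : actTensor g'.1.val g'.2.1.val g'.2.2.val t
        = 0
    · refine ⟨(1, 1, 1), by simpa using ht, ?_⟩
      rw [h, quantumEntropy_zero]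
      exact quantumEntropy_nonneg hθ.1 _
    · exact ⟨g', h, le_rfl⟩
  have hkey := logb_two_rpow_add_le_logQuantumFunctional hθ s t g₁ g₂ hg₁ hg₂
  have hpos : (0 : ℝ) < (2 : ℝ) ^ quantumEntropy θ
        (actTensor g₁.1.val g₁.2.1.val g₁.2.2.val s) +
      (2 : ℝ) ^ quantumEntropy θ
        (actTensor g₂.1.val g₂.2.1.val g₂.2.2.val t) :=
    add_pos (Real.rpow_pos_of_pos two_pos _) (Real.rpow_pos_of_pos two_pos _)
  have h' := (Real.logb_le_iff_le_rpow one_lt_two hpos).1 hkey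
  calc _ ≤ (2 : ℝ) ^ quantumEntropy θ
        (actTensor g₁.1.val g₁.2.1.val g₁.2.2.val s) +
      (2 : ℝ) ^ quantumEntropy θ
        (actTensor g₂.1.val g₂.2.1.val g₂.2.2.val t) :=
        add_le_add (Real.rpow_le_rpow_of_exponent_le one_le_two hle₁)
          (Real.rpow_le_rpow_of_exponent_le one_le_two hle₂)
    _ ≤ _ := h'

/-- **CVZ Lemma 3.22 in exponential form**: `2^{E_θ(s)} + 2^{E_θ(t)} ≤ 2^{E_θ(s ⊕ t)}` for
`s, t ≠ 0` (suprema taken one at a time). [cite: ChristandlVranaZuiddam2023, Lemma 3.22] -/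
theorem rpow_logQuantumFunctional_add_le {θ : Fin 3 → ℝ} (hθ : θ ∈ stdSimplex ℝ (Fin 3))
    {s : ι → κ → μ → ℂ} {t : ι' → κ' → μ' → ℂ} (hs : s ≠ 0) (ht : t ≠ 0) :
    (2 : ℝ) ^ logQuantumFunctional θ s + (2 : ℝ) ^ logQuantumFunctional θ t ≤
      (2 : ℝ) ^ logQuantumFunctional θ (directSumTensor s t) := by
  set W := logQuantumFunctional θ (directSumTensor s t)
  have hW := rpow_add_rpow_le_rpow_logQuantumFunctional hθ hs ht
  -- first supremum
  have h1 : ∀ g' : GL ι' ℂ × GL κ' ℂ × GL μ' ℂ, (2 : ℝ) ^ logQuantumFunctional θ s +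
      (2 : ℝ) ^ quantumEntropy θ
        (actTensor g'.1.val g'.2.1.val g'.2.2.val t) ≤
      (2 : ℝ) ^ W := by
    intro g'
    set B := (2 : ℝ) ^ quantumEntropy θ
        (actTensor g'.1.val g'.2.1.val g'.2.2.val t)
    have hpos : 0 < (2 : ℝ) ^ W - B := by
      have := hW (1, 1, 1) g'
      linarith [Real.rpow_pos_of_pos two_pos (quantumEntropy θ
        (actTensor ((1 : GL ι ℂ) : Matrix ι ι ℂ) ((1 : GL κ ℂ) : Matrix κ κ ℂ)
          ((1 : GL μ ℂ) : Matrix μ μ ℂ) s))]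
    have hsup : logQuantumFunctional θ s ≤ Real.logb 2 ((2 : ℝ) ^ W - B) :=
      ciSup_le fun g => (Real.le_logb_iff_rpow_le one_lt_two hpos).2 (by linarith [hW g g'])
    have := (Real.le_logb_iff_rpow_le one_lt_two hpos).1 hsup
    linarith
  -- second supremum
  have hpos : 0 < (2 : ℝ) ^ W - (2 : ℝ) ^ logQuantumFunctional θ s := by
    have := h1 (1, 1, 1)
    linarith [Real.rpow_pos_of_pos two_pos (quantumEntropy θ
      (actTensor ((1 : GL ι' ℂ) : Matrix ι' ι' ℂ) ((1 : GL κ' ℂ) : Matrix κ' κ' ℂ)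
        ((1 : GL μ' ℂ) : Matrix μ' μ' ℂ) t))]
  have hsup : logQuantumFunctional θ t ≤
      Real.logb 2 ((2 : ℝ) ^ W - (2 : ℝ) ^ logQuantumFunctional θ s) :=
    ciSup_le fun g' => (Real.le_logb_iff_rpow_le one_lt_two hpos).2 (by linarith [h1 g'])
  have := (Real.le_logb_iff_rpow_le one_lt_two hpos).1 hsup
  linarith

/-- `E_θ(t) ≤ E_θ(0 ⊕ t)`: padding with zero blocks does not decrease the functional.
[cite: ChristandlVranaZuiddam2023, Rem. 3.17] -/
theorem logQuantumFunctional_le_directSumTensor_zero_left {θ : Fin 3 → ℝ}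
    (hθ : θ ∈ stdSimplex ℝ (Fin 3)) (t : ι' → κ' → μ' → ℂ) :
    logQuantumFunctional θ t ≤ logQuantumFunctional θ (directSumTensor (0 : ι → κ → μ → ℂ) t) := by
  refine ciSup_le fun g' => ?_
  have h := quantumEntropy_directSumTensor_smul_le hθ.1 (0 : ι → κ → μ → ℂ) t (1, 1, 1) g'
    (one_ne_zero (α := ℂ)) (one_ne_zero (α := ℂ))
  rwa [actTensor_zero, smul_zero, one_smul, quantumEntropy_directSumTensor_zero_left hθ] at h

/-- `E_θ(s) ≤ E_θ(s ⊕ 0)`. [cite: ChristandlVranaZuiddam2023, Rem. 3.17] -/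
theorem logQuantumFunctional_le_directSumTensor_zero_right {θ : Fin 3 → ℝ}
    (hθ : θ ∈ stdSimplex ℝ (Fin 3)) (s : ι → κ → μ → ℂ) :
    logQuantumFunctional θ s ≤
      logQuantumFunctional θ (directSumTensor s (0 : ι' → κ' → μ' → ℂ)) := by
  refine ciSup_le fun g => ?_
  have h := quantumEntropy_directSumTensor_smul_le hθ.1 s (0 : ι' → κ' → μ' → ℂ) g (1, 1, 1)
    (one_ne_zero (α := ℂ)) (one_ne_zero (α := ℂ))
  rwa [actTensor_zero, smul_zero, one_smul, quantumEntropy_directSumTensor_zero_right hθ] at h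

/-- **CVZ Thm. 3.19.2 (Lemma 3.22), pointwise form**: `F_θ(s) + F_θ(t) ≤ F_θ(s ⊕ t)` for
`θ ∈ P([3])`. [cite: ChristandlVranaZuiddam2023, Thm. 3.19.2] -/
theorem quantumFunctional_add_le_directSumTensor {θ : Fin 3 → ℝ} (hθ : θ ∈ stdSimplex ℝ (Fin 3))
    (s : ι → κ → μ → ℂ) (t : ι' → κ' → μ' → ℂ) :
    quantumFunctional θ s + quantumFunctional θ t ≤ quantumFunctional θ (directSumTensor s t) := by
  by_cases hs : s = 0
  · subst hs
    by_cases ht : t = 0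
    · subst ht
      rw [quantumFunctional_zero, quantumFunctional_zero, zero_add]
      exact quantumFunctional_nonneg θ _
    · have hst : directSumTensor (0 : ι → κ → μ → ℂ) t ≠ 0 :=
        fun h => ht ((directSumTensor_eq_zero_iff _ _).1 h).2
      rw [quantumFunctional_zero, zero_add, quantumFunctional_of_ne_zero θ ht,
        quantumFunctional_of_ne_zero θ hst]
      exact Real.rpow_le_rpow_of_exponent_le one_le_two
        (logQuantumFunctional_le_directSumTensor_zero_left hθ t)
  · by_cases ht : t = 0
    · subst ht
      have hst : directSumTensor s (0 : ι' → κ' → μ' → ℂ) ≠ 0 :=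
        fun h => hs ((directSumTensor_eq_zero_iff _ _).1 h).1
      rw [quantumFunctional_zero, add_zero, quantumFunctional_of_ne_zero θ hs,
        quantumFunctional_of_ne_zero θ hst]
      exact Real.rpow_le_rpow_of_exponent_le one_le_two
        (logQuantumFunctional_le_directSumTensor_zero_right hθ s)
    · have hst : directSumTensor s t ≠ 0 := fun h => hs ((directSumTensor_eq_zero_iff _ _).1 h).1
      rw [quantumFunctional_of_ne_zero θ hs, quantumFunctional_of_ne_zero θ ht,
        quantumFunctional_of_ne_zero θ hst]
      exact rpow_logQuantumFunctional_add_le hθ hs ht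

end Superadditive

/-! ## Named facts: the two halves of additivity, and the assembly -/

section Facts

/-- **CVZ, super-additivity of the quantum functional under direct sum** (Thm. 3.19.2 = Lemma 3.22,
for the functional `F_θ` of Def. 3.16, case `k = 3`): `F_θ(s ⊕ t) ≥ F_θ(s) + F_θ(t)` for
`θ ∈ P([3])`. Proved below (`ChristandlVranaZuiddam2023_directSum_superadditive_holds`).
[cite: ChristandlVranaZuiddam2023, Thm. 3.19.2] -/
def ChristandlVranaZuiddam2023_directSum_superadditive : Prop :=
  ∀ (θ : Fin 3 → ℝ), θ ∈ stdSimplex ℝ (Fin 3) →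
    ∀ {ι κ μ ι' κ' μ' : Type u} [Fintype ι] [Fintype κ] [Fintype μ] [Fintype ι'] [Fintype κ']
      [Fintype μ'] [DecidableEq ι] [DecidableEq κ] [DecidableEq μ] [DecidableEq ι'] [DecidableEq κ']
      [DecidableEq μ'] (s : ι → κ → μ → ℂ) (t : ι' → κ' → μ' → ℂ),
    quantumFunctional θ s + quantumFunctional θ t ≤ quantumFunctional θ (directSumTensor s t)

/-- **CVZ, sub-additivity of the quantum functional under direct sum** (the `≤` half of the
additivity in Cor. 3.31, case `k = 3`): `F_θ(s ⊕ t) ≤ F_θ(s) + F_θ(t)` for `θ ∈ P([3])` and the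
functional `F_θ` of Def. 3.16. In the source this is Lemma 3.11 (= Thm. 3.5.2, sub-additivity of
the representation-theoretic upper functional `F^θ` of Def. 3.3, via the semigroup property of
Littlewood–Richardson coefficients, Lemma 3.10.2) transported along `F^θ = F_θ` (Thm. 3.30, from
the spectrum estimation theorem 3.27 and the entanglement-polytope description Thm. 3.29).
[cite: ChristandlVranaZuiddam2023, Cor. 3.31 (Lemma 3.11 with Thm. 3.30)] -/
def ChristandlVranaZuiddam2023_directSum_subadditive : Prop :=
  ∀ (θ : Fin 3 → ℝ), θ ∈ stdSimplex ℝ (Fin 3) →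
    ∀ {ι κ μ ι' κ' μ' : Type u} [Fintype ι] [Fintype κ] [Fintype μ] [Fintype ι'] [Fintype κ']
      [Fintype μ'] [DecidableEq ι] [DecidableEq κ] [DecidableEq μ] [DecidableEq ι'] [DecidableEq κ']
      [DecidableEq μ'] (s : ι → κ → μ → ℂ) (t : ι' → κ' → μ' → ℂ),
    quantumFunctional θ (directSumTensor s t) ≤ quantumFunctional θ s + quantumFunctional θ t

/-- **Discharge of the super-additive half** (CVZ Thm. 3.19.2).
[cite: ChristandlVranaZuiddam2023, Thm. 3.19.2] -/
theorem ChristandlVranaZuiddam2023_directSum_superadditive_holds :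
    ChristandlVranaZuiddam2023_directSum_superadditive.{u} :=
  fun _θ hθ _ι _κ _μ _ι' _κ' _μ' _ _ _ _ _ _ _ _ _ _ _ _ s t =>
    quantumFunctional_add_le_directSumTensor hθ s t

/-- **Assembly**: additivity `F_θ(s ⊕ t) = F_θ(s) + F_θ(t)` (CVZ Cor. 3.31, the tree's
`ChristandlVranaZuiddam2023_directSum`) follows from the sub-additive half, the super-additive
half being proved. [cite: ChristandlVranaZuiddam2023, Cor. 3.31] -/
theorem ChristandlVranaZuiddam2023_directSum_of_subadditive
    (h : ChristandlVranaZuiddam2023_directSum_subadditive.{u}) :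
    ChristandlVranaZuiddam2023_directSum.{u} :=
  fun θ hθ _ι _κ _μ _ι' _κ' _μ' _ _ _ _ _ _ _ _ _ _ _ _ s t =>
    le_antisymm (h θ hθ s t) (quantumFunctional_add_le_directSumTensor hθ s t)

/-- Conversely the additivity fact yields its sub-additive half.
[cite: ChristandlVranaZuiddam2023, Cor. 3.31] -/
theorem ChristandlVranaZuiddam2023_directSum.subadditive
    (h : ChristandlVranaZuiddam2023_directSum.{u}) :
    ChristandlVranaZuiddam2023_directSum_subadditive.{u} :=
  fun θ hθ _ι _κ _μ _ι' _κ' _μ' _ _ _ _ _ _ _ _ _ _ _ _ s t => (h θ hθ s t).le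

/-- **The reduction is complete**: given the super-additivity proved here, CVZ additivity under
`⊕` is equivalent to its sub-additive half. [cite: ChristandlVranaZuiddam2023, Cor. 3.31] -/
theorem ChristandlVranaZuiddam2023_directSum_iff_subadditive :
    ChristandlVranaZuiddam2023_directSum.{u} ↔
      ChristandlVranaZuiddam2023_directSum_subadditive.{u} :=
  ⟨ChristandlVranaZuiddam2023_directSum.subadditive,
    ChristandlVranaZuiddam2023_directSum_of_subadditive⟩

end Facts

end Literature.Computability.AlgebraicComplexity

end
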